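import Mathlib
import Summits.QuantumFields.QCD.Theorems.WilsonQuarkChessboardBackgroundSchwarzIndex

/-!
# Block identification of the reindexed Wilson–Dirac matrix (helper for `BackgroundSchwarz`)

For a `U(N)` field `V`, a field `V₀` agreeing with `V` on the closed positive half, a field `V♯`
agreeing with the reflected field `Θcfg[V]` there, and a field `Vb` with the same hyperplane blocks,
the twisted rotated Wilson–Dirac matrix of `V`, reindexed by `Emb`, is the abstract block assembly
`𝕄(P(V₀); Q(V♯))` of `…BackgroundSchwarzBlock`: positive blocks from `V₀` (locality), reflected
blocks = `γ₀`-signed adjoints of the positive blocks of `V♯` (the reflection identity), hyperplane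
blocks from `Vb`, and all other couplings zero (`assemble_eq`).  This is Montvay–Münster's
decomposition (4.100)/(4.104) with the reflection symmetry (4.106), for an asymmetric background.
-/

noncomputable section

namespace Summit.QuantumFields.QCD.Theorems.BackgroundSchwarz

open Matrix Complex Finset
open Literature.MathematicalPhysics Literature.MathematicalPhysics.QuantumLattice
  Literature.MathematicalPhysics.QuantumFieldTheory Literature.Probability.LatticeModels

variable {L N : ℕ} [NeZero L] {K : ℕ}

local notation "𝕌" => Matrix.unitaryGroup (Fin N) ℂ
local notation "ρ₀" => Literature.MathematicalPhysics.QuantumLattice.unitaryFundamentalRep (Fin N) ℂ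
/-- Interior positive time `k + 1`. -/
local notation "τP[" k "]" => ((((k : ℕ) + 1 : ℕ) : ZMod L))
/-- Hyperplane times `0` and `K + 2 = L/2`. -/
local notation "τB[" c "]" => ((![(0 : ZMod L), ((K + 2 : ℕ) : ZMod L)] : Fin 2 → ZMod L) c)
/-- The swapped sign block. -/
local notation "σ2[" c "]" => ((![(1 : Fin 2), 0] : Fin 2 → Fin 2) c)
set_option quotPrecheck false in
/-- Positive interior index. -/
local notation "EP[" i "]" =>
  (((Fin.cons τP[i.2.1] i.2.2.1 : TorusSite 4 L)), i.2.2.2.1, spin4[i.1, i.2.2.2.2])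
set_option quotPrecheck false in
/-- Reflected interior index. -/
local notation "EN[" i "]" =>
  (((Fin.cons (-τP[i.2.1]) i.2.2.1 : TorusSite 4 L)), i.2.2.2.1, spin4[i.1, i.2.2.2.2])
set_option quotPrecheck false in
/-- Hyperplane index, first kind (`(+,0)`, `(-,L/2)`). -/
local notation "EB1[" i "]" =>
  (((Fin.cons τB[i.1] i.2.1 : TorusSite 4 L)), i.2.2.1, spin4[i.1, i.2.2.2])
set_option quotPrecheck false in
/-- Hyperplane index, second kind (`(-,0)`, `(+,L/2)`). -/
local notation "EB2[" i "]" =>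
  (((Fin.cons τB[i.1] i.2.1 : TorusSite 4 L)), i.2.2.1, spin4[σ2[i.1], i.2.2.2])
set_option quotPrecheck false in
/-- The `γ₀`-sign of a sign block. -/
local notation "sgn[" σ "]" => (if σ = (0 : Fin 2) then (1 : ℂ) else -1)

omit [NeZero L] in
/-- Product of two `γ₀`-signs. -/
theorem sgn_mul_sgn (σ σ' : Fin 2) : sgn[σ] * sgn[σ'] = if σ = σ' then 1 else -1 := by
  fin_cases σ <;> fin_cases σ' <;> simp

omit [NeZero L] in
/-- The `γ₀`-sign of the `-` block. -/
theorem sgn_one {σ : Fin 2} (h : σ = 1) : sgn[σ] = -1 := by subst h; simp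

omit [NeZero L] in
/-- The `γ₀`-sign of the `+` block. -/
theorem sgn_zero {σ : Fin 2} (h : σ = 0) : sgn[σ] = 1 := by subst h; simp

omit [NeZero L] in
/-- `σ2 1 = 0`. -/
theorem σ2_one_eq : σ2[(1 : Fin 2)] = 0 := rfl

omit [NeZero L] in
/-- `σ2 0 = 1`. -/
theorem σ2_zero_eq : σ2[(0 : Fin 2)] = 1 := rfl


section Assemble

/-- **Block identification.**  The twisted rotated Wilson–Dirac matrix of `V`, reindexed by `Emb`,
is the block assembly of `…BackgroundSchwarzBlock` with positive data from `V₀`, reflected data the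
`γ₀`-signed adjoints of the positive data of `V♯`, hyperplane blocks from `Vb`. -/
theorem assemble_eq (hK : L = 2 * K + 4) (m : ℝ) (V V₀ V' Vb : GaugeConfig 4 L 𝕌)
    (hV₀ : ∀ e : Edge 4 L, posE[L, e] → V e = V₀ e)
    (hV' : ∀ e : Edge 4 L, posE[L, e] → V' e = Θcfg[V] e)
    (hVb1 : (Matrix.of fun i j : Fin 2 × ((Fin 3 → ZMod L) × Fin N × Fin 2) =>
        rotD[ρ₀, apTw[L, V], m] EB1[i] EB1[j]) =
      Matrix.of fun i j : Fin 2 × ((Fin 3 → ZMod L) × Fin N × Fin 2) => rotD[ρ₀, apTw[L, Vb], m] EB1[i] EB1[j])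
    (hVb2 : (Matrix.of fun i j : Fin 2 × ((Fin 3 → ZMod L) × Fin N × Fin 2) =>
        rotD[ρ₀, apTw[L, V], m] EB2[i] EB2[j]) =
      Matrix.of fun i j : Fin 2 × ((Fin 3 → ZMod L) × Fin N × Fin 2) => rotD[ρ₀, apTw[L, Vb], m] EB2[i] EB2[j]) :
    (rotD[ρ₀, apTw[L, V], m]).submatrix
      (Sum.elim
        (Sum.elim
          (fun i : Fin 2 × Fin (K + 1) × ((Fin 3 → ZMod L) × Fin N × Fin 2) => EP[i])
          (fun i : Fin 2 × Fin (K + 1) × ((Fin 3 → ZMod L) × Fin N × Fin 2) => EN[i]))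
        (Sum.elim
          (fun i : Fin 2 × ((Fin 3 → ZMod L) × Fin N × Fin 2) => EB1[i])
          (fun i : Fin 2 × ((Fin 3 → ZMod L) × Fin N × Fin 2) => EB2[i])))
      (Sum.elim
        (Sum.elim
          (fun i : Fin 2 × Fin (K + 1) × ((Fin 3 → ZMod L) × Fin N × Fin 2) => EP[i])
          (fun i : Fin 2 × Fin (K + 1) × ((Fin 3 → ZMod L) × Fin N × Fin 2) => EN[i]))
        (Sum.elim
          (fun i : Fin 2 × ((Fin 3 → ZMod L) × Fin N × Fin 2) => EB1[i])
          (fun i : Fin 2 × ((Fin 3 → ZMod L) × Fin N × Fin 2) => EB2[i]))) =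
    Matrix.fromBlocks
      (Matrix.fromBlocks
        (Matrix.of fun i j => rotD[ρ₀, apTw[L, V₀], m] EP[i] EP[j]) 0 0
        (Matrix.diagonal (fun i : Fin 2 × Fin (K + 1) × ((Fin 3 → ZMod L) × Fin N × Fin 2) => sgn[i.1]) *
          (Matrix.of fun i j => rotD[ρ₀, apTw[L, V'], m] EP[i] EP[j])ᴴ *
          Matrix.diagonal (fun i : Fin 2 × Fin (K + 1) × ((Fin 3 → ZMod L) × Fin N × Fin 2) => sgn[i.1])))
      (Matrix.fromBlocks
        (Matrix.of fun i j => rotD[ρ₀, apTw[L, V₀], m] EP[i] EB1[j]) 0 0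
        (Matrix.diagonal (fun i : Fin 2 × Fin (K + 1) × ((Fin 3 → ZMod L) × Fin N × Fin 2) => sgn[i.1]) *
          (Matrix.of fun i j => rotD[ρ₀, apTw[L, V'], m] EB2[i] EP[j])ᴴ))
      (Matrix.fromBlocks 0
        (-((Matrix.of fun i j => rotD[ρ₀, apTw[L, V'], m] EP[i] EB1[j])ᴴ *
          Matrix.diagonal (fun i : Fin 2 × Fin (K + 1) × ((Fin 3 → ZMod L) × Fin N × Fin 2) => sgn[i.1])))
        (Matrix.of fun i j => rotD[ρ₀, apTw[L, V₀], m] EB2[i] EP[j]) 0)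
      (Matrix.fromBlocks
        (Matrix.of fun i j => rotD[ρ₀, apTw[L, Vb], m] EB1[i] EB1[j])
        (-(Matrix.of fun i j => rotD[ρ₀, apTw[L, V'], m] EB2[i] EB1[j])ᴴ)
        (Matrix.of fun i j => rotD[ρ₀, apTw[L, V₀], m] EB2[i] EB1[j])
        (Matrix.of fun i j => rotD[ρ₀, apTw[L, Vb], m] EB2[i] EB2[j])) := by
  haveI := fact_one_lt hK
  have hL4 : 4 ≤ L := by omega
  have hL2 := two_mul_half hK
  -- locality, for every pair of indices of the positive kinds
  have loc : ∀ p q : TorusSite 4 L × Fin N × Fin 4, (p.1 0).val ≤ L / 2 → (q.1 0).val ≤ L / 2 →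
      rotD[ρ₀, apTw[L, V], m] p q = rotD[ρ₀, apTw[L, V₀], m] p q :=
    fun p q hp hq => rotD_apTw_congr_of_pos ρ₀ hL4 V V₀ hV₀ m p q hp hq
  ext I J
  rcases I with ((i | i) | (i | i)) <;> rcases J with ((j | j) | (j | j)) <;>
    simp only [Matrix.submatrix_apply, Sum.elim_inl, Sum.elim_inr, Matrix.fromBlocks_apply₁₁,
      Matrix.fromBlocks_apply₁₂, Matrix.fromBlocks_apply₂₁, Matrix.fromBlocks_apply₂₂, Matrix.zero_apply,
      Matrix.neg_apply, Matrix.of_apply, Matrix.mul_diagonal, Matrix.diagonal_mul, Matrix.conjTranspose_apply]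
  -- (P, P): locality
  · exact loc _ _ (by dsimp only; rw [Fin.cons_zero]; exact val_τP_le hK _)
      (by dsimp only; rw [Fin.cons_zero]; exact val_τP_le hK _)
  -- (P, N): zero
  · exact rotD_cons_eq_zero ρ₀ (apTw[L, V]) m _ _ _ _ _ _ _ _ _ _ (τP_ne_neg_τP hK _ _)
      (fun h => absurd h (neg_τP_ne_τP_add_one hK _ _)) (fun h => absurd h (τP_ne_neg_τP_add_one hK _ _))
  -- (P, B1): locality
  · exact loc _ _ (by dsimp only; rw [Fin.cons_zero]; exact val_τP_le hK _)
      (by dsimp only; rw [Fin.cons_zero]; exact val_τB_le hK _)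
  -- (P, B2): zero
  · exact rotD_cons_eq_zero ρ₀ (apTw[L, V]) m _ _ _ _ _ _ _ _ _ _ (τP_ne_τB hK _ _)
      (fun h hs => by have := τB_eq_τP_add_one hK h; rw [this] at hs; exact absurd hs.2 (by decide))
      (fun h hs => by have := τP_eq_τB_add_one hK h; rw [this] at hs; exact absurd hs.2 (by decide))
  -- (N, P): zero
  · exact rotD_cons_eq_zero ρ₀ (apTw[L, V]) m _ _ _ _ _ _ _ _ _ _ (τP_ne_neg_τP hK _ _).symm
      (fun h => absurd h (τP_ne_neg_τP_add_one hK _ _)) (fun h => absurd h (neg_τP_ne_τP_add_one hK _ _))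
  -- (N, N): reflection of (P, P) of `V♯`
  · have h := rotD_apTw_reflect hL4 hL2 V V' hV' m (-τP[i.2.1]) (-τP[j.2.1]) i.2.2.1 j.2.2.1 i.2.2.2.1
      j.2.2.2.1 i.1 i.2.2.2.2 j.1 j.2.2.2.2 (sgn[i.1] * sgn[j.1]) (neg_τP_half hK _) (neg_τP_half hK _)
      (fun _ => sgn_mul_sgn _ _)
      (fun h hσ hσ' => ⟨half_le_val_neg_τP hK _, by
        rw [if_neg (val_neg_τP_add_one_ne hK h), sgn_one hσ, sgn_one hσ']; norm_num⟩)
      (fun h hσ hσ' => ⟨half_le_val_neg_τP hK _, by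
        rw [if_neg (val_neg_τP_add_one_ne hK h), sgn_zero hσ, sgn_zero hσ']; norm_num⟩)
    rw [neg_neg, neg_neg, mul_assoc, mul_comm (sgn[j.1]) _, ← mul_assoc] at h
    exact h
  -- (N, B1): zero
  · exact rotD_cons_eq_zero ρ₀ (apTw[L, V]) m _ _ _ _ _ _ _ _ _ _ (neg_τP_ne_τB hK _ _)
      (fun h hs => by have := (τB_eq_neg_τP_add_one hK h).1; rw [this] at hs; exact absurd hs.2 (by decide))
      (fun h hs => by have := (neg_τP_eq_τB_add_one hK h).1; rw [this] at hs; exact absurd hs.2 (by decide))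
  -- (N, B2): reflection of (B2, P) of `V♯`
  · have h := rotD_apTw_reflect hL4 hL2 V V' hV' m (-τP[i.2.1]) (τB[j.1]) i.2.2.1 j.2.1 i.2.2.2.1
      j.2.2.1 i.1 i.2.2.2.2 (σ2[j.1]) j.2.2.2 (sgn[i.1]) (neg_τP_half hK _) (τB_half hK _)
      (fun h => absurd h (neg_τP_ne_τB hK _ _))
      (fun h hσ _ => by
        obtain ⟨-, hk⟩ := τB_eq_neg_τP_add_one hK h
        exact ⟨half_le_val_neg_τP hK _, by rw [if_pos ((val_neg_τP_add_one_eq_iff hK _).2 hk), sgn_one hσ]⟩)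
      (fun h hσ _ => by
        obtain ⟨hc, -⟩ := neg_τP_eq_τB_add_one hK h
        refine ⟨?_, by rw [if_neg (val_τB_add_one_ne hK _), sgn_zero hσ]⟩
        rw [val_τB hK, if_neg (fun h0 => by rw [hc] at h0; exact absurd h0 (by decide)), half_eq hK])
    rw [neg_neg, neg_τB hK] at h
    refine Eq.trans ?_ ((Matrix.diagonal_mul _ _ i j).trans (by rw [Matrix.conjTranspose_apply])).symm
    exact h
  -- (B1, P): zero
  · exact rotD_cons_eq_zero ρ₀ (apTw[L, V]) m _ _ _ _ _ _ _ _ _ _ (τP_ne_τB hK _ _).symm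
      (fun h hs => by have := τP_eq_τB_add_one hK h; rw [this] at hs; exact absurd hs.1 (by decide))
      (fun h hs => by have := τB_eq_τP_add_one hK h; rw [this] at hs; exact absurd hs.1 (by decide))
  -- (B1, N): reflection of (P, B1) of `V♯`
  · have h := rotD_apTw_reflect hL4 hL2 V V' hV' m (τB[i.1]) (-τP[j.2.1]) i.2.1 j.2.2.1 i.2.2.1
      j.2.2.2.1 i.1 i.2.2.2 j.1 j.2.2.2.2 (-sgn[j.1]) (τB_half hK _) (neg_τP_half hK _)
      (fun h => absurd h.symm (neg_τP_ne_τB hK _ _))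
      (fun h _ hσ' => by
        obtain ⟨hc, -⟩ := neg_τP_eq_τB_add_one hK h
        refine ⟨?_, by rw [if_neg (val_τB_add_one_ne hK _), sgn_one hσ']; norm_num⟩
        rw [val_τB hK, if_neg (fun h0 => by rw [hc] at h0; exact absurd h0 (by decide)), half_eq hK])
      (fun h _ hσ' => by
        obtain ⟨-, hk⟩ := τB_eq_neg_τP_add_one hK h
        exact ⟨half_le_val_neg_τP hK _, by rw [if_pos ((val_neg_τP_add_one_eq_iff hK _).2 hk), sgn_zero hσ']⟩)
    rw [neg_neg, neg_τB hK, neg_mul, mul_comm (sgn[j.1]) _] at h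
    refine Eq.trans ?_ (congrArg Neg.neg ((Matrix.mul_diagonal _ _ i j).trans
      (by rw [Matrix.conjTranspose_apply]))).symm
    exact h
  -- (B1, B1): hyperplane block
  · exact congrFun (congrFun hVb1 i) j
  -- (B1, B2): reflection of (B2, B1) of `V♯`
  · have h := rotD_apTw_reflect hL4 hL2 V V' hV' m (τB[i.1]) (τB[j.1]) i.2.1 j.2.1 i.2.2.1 j.2.2.1 i.1
      i.2.2.2 (σ2[j.1]) j.2.2.2 (-1) (τB_half hK _) (τB_half hK _)
      (fun h => by
        rw [if_neg]
        intro hσ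
        rw [τB_inj hK h] at hσ
        exact σ2_ne j.1 hσ.symm)
      (fun h => absurd h (τB_ne_τB_add_one hK _ _))
      (fun h => absurd h (τB_ne_τB_add_one hK _ _))
    rw [neg_τB hK, neg_τB hK, neg_one_mul] at h
    exact h
  -- (B2, P): locality
  · exact loc _ _ (by dsimp only; rw [Fin.cons_zero]; exact val_τB_le hK _)
      (by dsimp only; rw [Fin.cons_zero]; exact val_τP_le hK _)
  -- (B2, N): zero
  · exact rotD_cons_eq_zero ρ₀ (apTw[L, V]) m _ _ _ _ _ _ _ _ _ _ (neg_τP_ne_τB hK _ _).symm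
      (fun h hs => by have := (neg_τP_eq_τB_add_one hK h).1; rw [this] at hs; exact absurd hs.1 (by decide))
      (fun h hs => by have := (τB_eq_neg_τP_add_one hK h).1; rw [this] at hs; exact absurd hs.1 (by decide))
  -- (B2, B1): locality
  · exact loc _ _ (by dsimp only; rw [Fin.cons_zero]; exact val_τB_le hK _)
      (by dsimp only; rw [Fin.cons_zero]; exact val_τB_le hK _)
  -- (B2, B2): hyperplane block
  · exact congrFun (congrFun hVb2 i) j

end Assemble

end Summit.QuantumFields.QCD.Theorems.BackgroundSchwarz
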